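import Summits.Ventures.CertifiedManyBodySolver.Observables.NeelClassFloorCubic
import Summits.Ventures.CertifiedManyBodySolver.Observables.NeelClassFloorAbsBand
import HarnessLib

/-!
# Ventures/CertifiedManyBodySolver — Observables/NeelClassFloorAbs.lean
# The SDW-reference kinetic floor with majorants in `|ε|`: `Σε² = 4L²`, `Σε⁴ = 36L²`, `Σε⁶ = 400L²` AND `Σ|ε| ≤ 1.6212·L²`

HONEST FRAMING: first certified bounds; not a superconductivity verdict; every number certified or labelled float.
A competing-order EXCLUSION removes a named class of candidate ground states; it never says which order is present;
no phase sentence follows.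

Cell `hubbard-tc` (MO-S3), seat `hubbard-tc-mod-3` (G3), `prover-hubbard-tc-mod-3-g8-0` (§E W3-11b′). The `|ε|`-twin of
`NeelClassFloorCubic.lean`: for every majorant `√(u² + Δ²) ≤ α + βu + γu² + κu⁴ + μu⁶` on `u ∈ [0, 4|t|]` with `β ≥ 0`
(`L ≥ 7` even) `tr E ≤ L²(α + 1.6212|t|β + 4t²γ + 36t⁴κ + 400t⁶μ)` (`trace_sdwE_matrix_le_abs`; the kink of `|ε|` is carried EXACTLY by the
first absolute moment `Σ_k|ε_k| = |t|(16/sin²(π/L) − 8) ≤ 1.6212|t|L²` of `NeelClassFloorAbsBand.lean`, the even powers by the torus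
characters), the kinetic floor `re_expect_hubbardTorusTT'_zero_ge_sdw_abs` and the class floors `re_expect_hubbardTorusTT'_ge_neelClass_abs` /
`neelClass_energy_per_site_ge_abs`: energy per site `≥ 2δ|m| + δ(1 − n) − (α + 1.6212β + 4γ + 36κ + 400μ) + U(n²/4 − m²)` (t = 1).
At small `δ` this removes most of the polynomial-majorant loss (LP design `g8-replay/lp.py` [float]: band-average loss at `δ = 0.2` is
0.029 with `{1, u, u², u⁴}` vs 0.102 with the cubic menu in `x = ε²`). Everything is PROVED; no definition, no `sorry`.
References: E. H. Lieb, M. Loss, Duke Math. J. 71 (1993) 337, §8 [LiebLoss1993]; V. Bach, E. H. Lieb, J. P. Solovej, J. Stat. Phys. 76 (1994) 3, §2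
eq. (2c.36) [BachLiebSolovej1994]; J. S. Langer, D. C. Mattis (1971) eq. (3) [LangerMattis1971].
-/

noncomputable section

namespace Summit.Ventures.CertifiedManyBodySolver.Observables

namespace NeelClassFloor

open Literature.MathematicalPhysics.QuantumLattice

open Matrix Finset Literature.Probability.LatticeModels
  Literature.MathematicalPhysics.QuantumLattice.RayleighBound
  Literature.MathematicalPhysics.QuantumLattice.HubbardBandBottom
  Literature.MathematicalPhysics.QuantumLattice.LangerMattis
  Literature.MathematicalPhysics.QuantumLattice.HartreeFock
  Literature.MathematicalPhysics.QuantumLattice.TTPrimeFree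
  Literature.MathematicalPhysics.QuantumLattice.FreeKinetic
open scoped ComplexOrder ComplexConjugate

variable {L : ℕ}

section Main

variable [NeZero L]

/-! ### `|ε|`-majorants of `√(ε² + Δ²)` and the absolute-moment floors -/

/-- **`tr E ≤ L²(α + 1.6212|t|β + 4t²γ + 36t⁴κ + 400t⁶μ)`** for every majorant `√(u² + Δ²) ≤ α + βu + γu² + κu⁴ + μu⁶` on `u ∈ [0, 4|t|]`
with `β ≥ 0` (`L ≥ 7` even; uses `Σ_k|ε_k| ≤ 1.6212|t|L²`, `Σ ε² = 4t²L²`, `Σ ε⁴ = 36t⁴L²`, `Σ ε⁶ = 400t⁶L²`). [cite: LiebLoss1993, §8] -/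
theorem trace_sdwE_matrix_le_abs (hL : 7 ≤ L) (hLe : Even L) (t : ℝ) {Δ α β γ κ μ : ℝ} (hΔ : Δ ≠ 0) (hβ : 0 ≤ β)
    (hq : ∀ u : ℝ, 0 ≤ u → u ≤ 4 * |t| → Real.sqrt (u ^ 2 + Δ ^ 2) ≤ α + β * u + γ * u ^ 2 + κ * u ^ 4 + μ * u ^ 6) :
    ((sdwM 2 L t Δ * sdwR 2 L t Δ).trace).re ≤
      (L : ℝ) ^ 2 * (α + 1.6212 * |t| * β + 4 * t ^ 2 * γ + 36 * t ^ 4 * κ + 400 * t ^ 6 * μ) := by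
  have hL3 : 3 ≤ L := by omega
  have hL5 : 5 ≤ L := by omega
  have hL6 : 6 ≤ L := by omega
  rw [trace_sdwE_matrix hL3 t hΔ, Complex.re_sum]
  simp only [Complex.ofReal_re]
  have hk : ∀ k : FermionTorus 2 L, sdwE t Δ k ≤
      α + β * |siteBand t k| + γ * siteBand t k ^ 2 + κ * siteBand t k ^ 4 + μ * siteBand t k ^ 6 := by
    intro k
    have hu : |siteBand t k| ≤ 4 * |t| :=
      abs_le_of_sq_le_sq (by rw [mul_pow, sq_abs]; linarith [siteBand_sq_le t k]) (by positivity)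
    have h := hq |siteBand t k| (abs_nonneg _) hu
    rw [sq_abs] at h
    have e4 : |siteBand t k| ^ 4 = siteBand t k ^ 4 := by
      rw [show (4 : ℕ) = 2 * 2 from rfl, pow_mul, sq_abs, ← pow_mul]
    have e6 : |siteBand t k| ^ 6 = siteBand t k ^ 6 := by
      rw [show (6 : ℕ) = 2 * 3 from rfl, pow_mul, sq_abs, ← pow_mul]
    rw [e4, e6] at h
    rw [sdwE]
    exact h
  have hcard : (Finset.univ : Finset (FermionTorus 2 L)).card = L ^ 2 := by
    rw [Finset.card_univ, card_fermionTorus_eq]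
  have habs := sum_abs_siteBand_le (L := L) hLe hL6 t
  calc ∑ k : FermionTorus 2 L, sdwE t Δ k
      ≤ ∑ k : FermionTorus 2 L, (α + β * |siteBand t k| + γ * siteBand t k ^ 2 + κ * siteBand t k ^ 4 + μ * siteBand t k ^ 6) :=
        Finset.sum_le_sum fun k _ => hk k
    _ = (L : ℝ) ^ 2 * α + β * ∑ k : FermionTorus 2 L, |siteBand t k| +
          (L : ℝ) ^ 2 * (4 * t ^ 2 * γ + 36 * t ^ 4 * κ + 400 * t ^ 6 * μ) := by
        simp only [Finset.sum_add_distrib, Finset.sum_const, hcard, ← Finset.mul_sum,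
          sum_siteBand_sq hL3, sum_siteBand_pow_four hL5, sum_siteBand_pow_six hL, nsmul_eq_mul]
        push_cast
        ring
    _ ≤ (L : ℝ) ^ 2 * (α + 1.6212 * |t| * β + 4 * t ^ 2 * γ + 36 * t ^ 4 * κ + 400 * t ^ 6 * μ) := by
        nlinarith [mul_le_mul_of_nonneg_left habs hβ]

/-- **The absolute-moment SDW-reference kinetic floor** (`t' ≤ 0`, `L ≥ 7` even): for every real `Δ ≠ 0` with
`4|t'| ≤ |Δ|`, `|Δ||t'| ≤ 2(t² - t'²)`, every majorant `√(u² + Δ²) ≤ α + βu + γu² + κu⁴ + μu⁶` on `[0, 4|t|]` with `β ≥ 0` and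
every Fock vector `φ`: `-Δ Re⟨φ, Ôφ⟩ + |Δ|(L²‖φ‖² - Re⟨φ, N̂φ⟩) - L²(α + 1.6212|t|β + 4t²γ + 36t⁴κ + 400t⁶μ)‖φ‖² ≤ Re⟨φ, H(t,t',0)φ⟩`.
[cite: LiebLoss1993, §8, Theorem 8.2] -/
theorem re_expect_hubbardTorusTT'_zero_ge_sdw_abs (hL : 7 ≤ L) (hLe : Even L) (t : ℝ) {t' Δ α β γ κ μ : ℝ}
    (ht' : t' ≤ 0) (hΔ : Δ ≠ 0) (h4 : 4 * |t'| ≤ |Δ|) (hD : |Δ| * |t'| ≤ 2 * (t ^ 2 - t' ^ 2)) (hβ : 0 ≤ β)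
    (hq : ∀ u : ℝ, 0 ≤ u → u ≤ 4 * |t| → Real.sqrt (u ^ 2 + Δ ^ 2) ≤ α + β * u + γ * u ^ 2 + κ * u ^ 4 + μ * u ^ 6)
    (φ : Fock (Orb (FermionTorus 2 L))) :
    -Δ * (star φ ⬝ᵥ ((dGammaSpin 0 (stagMatrix 2 L) - dGammaSpin 1 (stagMatrix 2 L)) *ᵥ φ)).re +
        |Δ| * ((L : ℝ) ^ 2 * normSq φ - (star φ ⬝ᵥ (totalNumber *ᵥ φ)).re) -
        (L : ℝ) ^ 2 * (α + 1.6212 * |t| * β + 4 * t ^ 2 * γ + 36 * t ^ 4 * κ + 400 * t ^ 6 * μ) * normSq φ ≤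
      (star φ ⬝ᵥ (hubbardTorusTT' L t t' 0 *ᵥ φ)).re := by
  have hL3 : 3 ≤ L := by omega
  have hq' : ∀ u : ℝ, 0 ≤ u → u ≤ 4 * |(-t)| → Real.sqrt (u ^ 2 + Δ ^ 2) ≤ α + β * u + γ * u ^ 2 + κ * u ^ 4 + μ * u ^ 6 := by
    intro u h0 h1; rw [abs_neg] at h1; exact hq u h0 h1
  have hB := trace_sdwE_matrix_le_abs hL hLe (-t) hΔ hβ hq'
  rw [abs_neg, neg_sq, show (-t) ^ 4 = t ^ 4 by ring, show (-t) ^ 6 = t ^ 6 by ring] at hB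
  exact re_expect_hubbardTorusTT'_zero_ge_sdw_of_trace_le hL3 hLe t ht' hΔ h4 hD hB φ

/-- **The absolute-moment energy floor of the Néel mean-field class** (`t' ≤ 0`, `U ≥ 0`, `L ≥ 7` even): under the class
hypotheses (density `n`, staggered magnetisation `m`, `Re⟨D̂⟩ ≥ (n²/4 - m²)L²‖φ‖²), for every `δ > 0` with `4|t'| ≤ δ`,
`δ|t'| ≤ 2(t² - t'²)` and every majorant `√(u² + δ²) ≤ α + βu + γu² + κu⁴ + μu⁶` on `[0, 4|t|]` with `β ≥ 0`:
`Re⟨φ, H(t,t',U)φ⟩ ≥ L²‖φ‖²(2δ|m| + δ(1 - n) - (α + 1.6212|t|β + 4t²γ + 36t⁴κ + 400t⁶μ) + U(n²/4 - m²))`.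
[cite: BachLiebSolovej1994, §2 eq. (2c.36)] -/
theorem re_expect_hubbardTorusTT'_ge_neelClass_abs (hL : 7 ≤ L) (hLe : Even L) (t : ℝ) {t' U δ n m α β γ κ μ : ℝ}
    (ht' : t' ≤ 0) (hU : 0 ≤ U) (hδ : 0 < δ) (h4 : 4 * |t'| ≤ δ) (hD : δ * |t'| ≤ 2 * (t ^ 2 - t' ^ 2)) (hβ : 0 ≤ β)
    (hq : ∀ u : ℝ, 0 ≤ u → u ≤ 4 * |t| → Real.sqrt (u ^ 2 + δ ^ 2) ≤ α + β * u + γ * u ^ 2 + κ * u ^ 4 + μ * u ^ 6)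
    (φ : Fock (Orb (FermionTorus 2 L)))
    (hN : (star φ ⬝ᵥ (totalNumber *ᵥ φ)).re = n * (L : ℝ) ^ 2 * normSq φ)
    (hO : (star φ ⬝ᵥ ((dGammaSpin 0 (stagMatrix 2 L) - dGammaSpin 1 (stagMatrix 2 L)) *ᵥ φ)).re =
      2 * m * (L : ℝ) ^ 2 * normSq φ)
    (hDocc : (n ^ 2 / 4 - m ^ 2) * (L : ℝ) ^ 2 * normSq φ ≤
      (star φ ⬝ᵥ ((∑ x : FermionTorus 2 L, numberOp x 0 * numberOp x 1) *ᵥ φ)).re) :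
    (L : ℝ) ^ 2 * normSq φ *
        (2 * δ * |m| + δ * (1 - n) - (α + 1.6212 * |t| * β + 4 * t ^ 2 * γ + 36 * t ^ 4 * κ + 400 * t ^ 6 * μ) +
          U * (n ^ 2 / 4 - m ^ 2)) ≤
      (star φ ⬝ᵥ (hubbardTorusTT' L t t' U *ᵥ φ)).re := by
  have hU' : (star φ ⬝ᵥ (hubbardTorusTT' L t t' U *ᵥ φ)).re =
      (star φ ⬝ᵥ (hubbardTorusTT' L t t' 0 *ᵥ φ)).re +
        U * (star φ ⬝ᵥ ((∑ x : FermionTorus 2 L, numberOp x 0 * numberOp x 1) *ᵥ φ)).re := by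
    rw [hubbardTorusTT'_eq_add_smul t t' 0 U, Matrix.add_mulVec, dotProduct_add, Complex.add_re,
      Matrix.smul_mulVec, dotProduct_smul, smul_eq_mul, Complex.re_ofReal_mul, sub_zero]
  have hnn : 0 ≤ normSq φ := normSq_nonneg φ
  have hL2 : 0 ≤ (L : ℝ) ^ 2 * normSq φ := by positivity
  rcases le_or_gt 0 m with hm | hm
  · have hΔ : (-δ) ≠ 0 := by linarith
    have h4' : 4 * |t'| ≤ |(-δ)| := by rw [abs_neg, abs_of_pos hδ]; exact h4
    have hD' : |(-δ)| * |t'| ≤ 2 * (t ^ 2 - t' ^ 2) := by rw [abs_neg, abs_of_pos hδ]; exact hD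
    have hqn : ∀ u : ℝ, 0 ≤ u → u ≤ 4 * |t| → Real.sqrt (u ^ 2 + (-δ) ^ 2) ≤ α + β * u + γ * u ^ 2 + κ * u ^ 4 + μ * u ^ 6 := by
      intro u h0 h1; rw [neg_sq]; exact hq u h0 h1
    have h := re_expect_hubbardTorusTT'_zero_ge_sdw_abs hL hLe t ht' hΔ h4' hD' hβ hqn φ
    rw [abs_neg, abs_of_pos hδ, hO, hN] at h
    rw [hU', abs_of_nonneg hm]
    nlinarith [mul_le_mul_of_nonneg_left hDocc hU]
  · have hΔ : δ ≠ 0 := hδ.ne'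
    have h4' : 4 * |t'| ≤ |δ| := by rw [abs_of_pos hδ]; exact h4
    have hD' : |δ| * |t'| ≤ 2 * (t ^ 2 - t' ^ 2) := by rw [abs_of_pos hδ]; exact hD
    have h := re_expect_hubbardTorusTT'_zero_ge_sdw_abs hL hLe t ht' hΔ h4' hD' hβ hq φ
    rw [abs_of_pos hδ, hO, hN] at h
    rw [hU', abs_of_neg hm]
    nlinarith [mul_le_mul_of_nonneg_left hDocc hU]

/-- **Per-site form** (`φ ≠ 0`): under the hypotheses of `re_expect_hubbardTorusTT'_ge_neelClass_abs`, the energy per site of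
every state of the Néel mean-field class is at least `2δ|m| + δ(1 - n) - (α + 1.6212|t|β + 4t²γ + 36t⁴κ + 400t⁶μ) + U(n²/4 - m²)`.
[cite: BachLiebSolovej1994, §2 eq. (2c.36)] -/
theorem neelClass_energy_per_site_ge_abs (hL : 7 ≤ L) (hLe : Even L) (t : ℝ) {t' U δ n m α β γ κ μ : ℝ}
    (ht' : t' ≤ 0) (hU : 0 ≤ U) (hδ : 0 < δ) (h4 : 4 * |t'| ≤ δ) (hD : δ * |t'| ≤ 2 * (t ^ 2 - t' ^ 2)) (hβ : 0 ≤ β)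
    (hq : ∀ u : ℝ, 0 ≤ u → u ≤ 4 * |t| → Real.sqrt (u ^ 2 + δ ^ 2) ≤ α + β * u + γ * u ^ 2 + κ * u ^ 4 + μ * u ^ 6)
    {φ : Fock (Orb (FermionTorus 2 L))} (hφ : φ ≠ 0)
    (hN : (star φ ⬝ᵥ (totalNumber *ᵥ φ)).re = n * (L : ℝ) ^ 2 * normSq φ)
    (hO : (star φ ⬝ᵥ ((dGammaSpin 0 (stagMatrix 2 L) - dGammaSpin 1 (stagMatrix 2 L)) *ᵥ φ)).re =
      2 * m * (L : ℝ) ^ 2 * normSq φ)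
    (hDocc : (n ^ 2 / 4 - m ^ 2) * (L : ℝ) ^ 2 * normSq φ ≤
      (star φ ⬝ᵥ ((∑ x : FermionTorus 2 L, numberOp x 0 * numberOp x 1) *ᵥ φ)).re) :
    2 * δ * |m| + δ * (1 - n) - (α + 1.6212 * |t| * β + 4 * t ^ 2 * γ + 36 * t ^ 4 * κ + 400 * t ^ 6 * μ) +
        U * (n ^ 2 / 4 - m ^ 2) ≤
      (star φ ⬝ᵥ (hubbardTorusTT' L t t' U *ᵥ φ)).re / ((L : ℝ) ^ 2 * normSq φ) := by
  have h := re_expect_hubbardTorusTT'_ge_neelClass_abs hL hLe t ht' hU hδ h4 hD hβ hq φ hN hO hDocc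
  have hpos : 0 < normSq φ := by
    rcases (normSq_nonneg φ).lt_or_eq with hlt | heq
    · exact hlt
    · exact absurd (eq_zero_of_normSq_eq_zero heq.symm) hφ
  have hL0 : (0 : ℝ) < (L : ℝ) ^ 2 := by
    have : (0 : ℝ) < L := by exact_mod_cast (lt_of_lt_of_le (by norm_num : 0 < 7) hL)
    positivity
  rw [le_div_iff₀ (mul_pos hL0 hpos)]
  linarith

end Main

end NeelClassFloor

end Summit.Ventures.CertifiedManyBodySolver.Observables

end
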